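import Literature.Computability.Complexity.MatchingExtensionComplexity
import Literature.Computability.Complexity.RectangleCorruptionBound
import Literature.Probability.LatticeModels.PerfectMatchingCount
import HarnessLib

/-!
# Rothvoss's theorem, outer layer: from the rectangle bound (Lemma 6) to the slack-matrix bound

Sibling proof file of `MatchingExtensionComplexity.lean` for the named fact
`Literature.Computability.Complexity.rothvoss_matching_slack_bound` (T. Rothvoss, *The matching
polytope has exponential extension complexity*, J. ACM 64 (2017) 41, Theorem 1 in slack form).
This file PROVES the part of the paper that surrounds its "main technical ingredient": §2 from
display (2) onwards — *Lemma 6 ⇒ Theorem 1* via the hyperplane separation bound (Lemma 5, proved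
in `RectangleCorruptionBound.lean`) — together with the footnote on p. 6 ("we show a lower bound only
… for certain `n` … `P_M(n)` is a face of `P_M(n')` for `n ≤ n'` … Thus the lower bound … holds for
every even `n`"), here carried out on slack matrices:

* `Rothvoss.crossing U M = |M ∩ δ(U)|` (verbatim the quantity of the fact) and its partner-map form
  `crossing_eq_card_filter`: for a perfect matching with partner map `f`
  (`Literature.Probability.LatticeModels.matchPartner`), `|M ∩ δ(U)| = #{x ∈ U : f x ∉ U}`.
* `Rothvoss.factorisation_restrict`: a non-negative factorisation of the odd-cut slack matrix of
  `K_n` restricts to one of `K_{n₀}` with the same number of terms (`n₀ ≤ n`, `n - n₀` even): cuts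
  are pushed forward along `Fin n₀ ↪ Fin n`, matchings are padded by the fixed matching
  `{n₀, n₀+1}, {n₀+2, n₀+3}, …` (`padMap`, `padMatching`, `crossing_pad`).
* `Rothvoss.rvN k m = 3m(k-3) + 2k`, `Rothvoss.rvT k m = (m+1)/2 · (k-3) + 3` (the paper's `n` and
  `t`, p. 6) and `Rothvoss.exists_param` (every large `n` dominates some `rvN k m`, `m` odd, with
  `m ≥ 3n / (4 · 3(k-3))`).
* `rothvoss_matching_slack_bound_of_rectangle_bound`: **if** for some odd `k > 3` and `δ > 0`, for
  all large odd `m`, there is a weight `W` on (t-cuts) × (perfect matchings) of `K_{rvN k m}` with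
  `⟨W, S⟩ ≥ 1` and `⟨W, R⟩ ≤ 2^{-δ m}` for every rectangle `R` avoiding the entries with
  `|M ∩ δ(U)| = 1` — this is exactly the conjunction "(2) and Lemma 6" of the paper, whose proof
  (Lemma 7, §3) is the remaining work — **then** `rothvoss_matching_slack_bound`.

Nothing here introduces a named fact; the hypothesis of the last theorem is stated inline.

## References

* T. Rothvoss, *The matching polytope has exponential extension complexity*, J. ACM 64(6) (2017)
  41:1–41:19 (arXiv:1311.2369v3), §2: Lemma 5, display (2), Lemma 6, footnote 2 [Rothvoss2017].
-/

namespace Literature.Computability.Complexity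

open Finset
open Literature.Probability.LatticeModels

namespace Rothvoss

/-! ### The crossing number `|M ∩ δ(U)|` through partner maps -/

section Crossing

variable {n : ℕ}

/-- The number `|M ∩ δ(U)|` of edges of the subgraph `M` of `K_n` with exactly one endpoint in
`U` — verbatim the quantity `(M.edgeSet ∩ {e | ∃ x ∈ U, ∃ y ∉ U, e = s(x, y)}).ncard` of
`rothvoss_matching_slack_bound` (Rothvoss 2017, §2: `S_{UM} = |M ∩ δ(U)| - 1`).
[cite: Rothvoss2017, §2] -/
noncomputable def crossing (U : Finset (Fin n)) (M : (⊤ : SimpleGraph (Fin n)).Subgraph) : ℕ :=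
  (M.edgeSet ∩ {e | ∃ x ∈ U, ∃ y ∉ U, e = s(x, y)}).ncard

/-- The partner map of the matching built from a partner map `f` is `f`. [folklore] -/
theorem matchPartner_partnerSubgraph {W : Type*} (G : SimpleGraph W) (f : W → W)
    (hf : ∀ v, G.Adj v (f v) ∧ f (f v) = v) (v : W) :
    matchPartner (partnerSubgraph_isPerfectMatching G f hf) v = f v :=
  (eq_matchPartner_of_adj (partnerSubgraph_isPerfectMatching G f hf) (v := v) (w := f v) rfl).symm

/-- **Crossing number of a perfect matching through its partner map**: the crossing edges of a
perfect matching `M` of `K_n` over a vertex set `U` are in bijection (`x ↦ {x, f x}`) with the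
vertices `x ∈ U` whose partner `f x` lies outside `U`. [folklore] -/
theorem crossing_eq_card_filter (U : Finset (Fin n)) {M : (⊤ : SimpleGraph (Fin n)).Subgraph}
    (hM : M.IsPerfectMatching) :
    crossing U M = (U.filter fun x => matchPartner hM x ∉ U).card := by
  classical
  have hset : M.edgeSet ∩ {e | ∃ x ∈ U, ∃ y ∉ U, e = s(x, y)} =
      (fun x => s(x, matchPartner hM x)) '' ↑(U.filter fun x => matchPartner hM x ∉ U) := by
    ext e
    simp only [Set.mem_inter_iff, Set.mem_setOf_eq, Set.mem_image, coe_filter]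
    constructor
    · rintro ⟨he, x, hx, y, hy, rfl⟩
      have hyx : y = matchPartner hM x :=
        eq_matchPartner_of_adj hM (SimpleGraph.Subgraph.mem_edgeSet.1 he)
      subst hyx
      exact ⟨x, ⟨hx, hy⟩, rfl⟩
    · rintro ⟨x, ⟨hx, hxU⟩, rfl⟩
      exact ⟨SimpleGraph.Subgraph.mem_edgeSet.2 (adj_matchPartner hM x), x, hx,
        matchPartner hM x, hxU, rfl⟩
  unfold crossing
  rw [hset, Set.InjOn.ncard_image, Set.ncard_coe_finset]
  rintro x hx x' hx' h
  simp only [coe_filter, Set.mem_setOf_eq] at hx hx'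
  rcases Sym2.eq_iff.1 h with ⟨h1, -⟩ | ⟨h1, -⟩
  · exact h1
  · subst h1
    exact absurd hx.1 hx'.2

/-- A perfect matching crosses a vertex set `U` in at most `|U|` edges. [folklore] -/
theorem crossing_le_card (U : Finset (Fin n)) {M : (⊤ : SimpleGraph (Fin n)).Subgraph}
    (hM : M.IsPerfectMatching) : crossing U M ≤ U.card := by
  rw [crossing_eq_card_filter U hM]
  exact card_filter_le _ _

end Crossing

/-! ### Restricting a factorisation from `K_n` to `K_{n₀}` (footnote 2 of the paper) -/

section Pad

variable {n₀ n : ℕ}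

/-- Value-level padding of a partner map `f` on `{0, …, n₀-1}`: `f` below `n₀`, and above `n₀`
the fixed pairing `n₀ ↔ n₀+1`, `n₀+2 ↔ n₀+3`, …. [folklore] -/
def padVal (n₀ : ℕ) (f : Fin n₀ → Fin n₀) (x : ℕ) : ℕ :=
  if hx : x < n₀ then (f ⟨x, hx⟩ : ℕ) else if (x - n₀) % 2 = 0 then x + 1 else x - 1

/-- `padVal` below `n₀`. [folklore] -/
theorem padVal_of_lt (f : Fin n₀ → Fin n₀) {x : ℕ} (hx : x < n₀) :
    padVal n₀ f x = f ⟨x, hx⟩ := by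
  simp [padVal, hx]

/-- `padVal` at even offset above `n₀`. [folklore] -/
theorem padVal_of_ge_even (f : Fin n₀ → Fin n₀) {x : ℕ} (hx : n₀ ≤ x) (hp : (x - n₀) % 2 = 0) :
    padVal n₀ f x = x + 1 := by
  simp [padVal, not_lt.2 hx, hp]

/-- `padVal` at odd offset above `n₀`. [folklore] -/
theorem padVal_of_ge_odd (f : Fin n₀ → Fin n₀) {x : ℕ} (hx : n₀ ≤ x) (hp : (x - n₀) % 2 = 1) :
    padVal n₀ f x = x - 1 := by
  simp [padVal, not_lt.2 hx, hp]

/-- `padVal` stays below `n` when `n - n₀` is even. [folklore] -/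
theorem padVal_lt (h : n₀ ≤ n) (he : (n - n₀) % 2 = 0) (f : Fin n₀ → Fin n₀) {x : ℕ}
    (hx : x < n) : padVal n₀ f x < n := by
  by_cases hx₀ : x < n₀
  · rw [padVal_of_lt f hx₀]
    exact lt_of_lt_of_le (f ⟨x, hx₀⟩).2 h
  · push Not at hx₀
    by_cases hp : (x - n₀) % 2 = 0
    · rw [padVal_of_ge_even f hx₀ hp]
      omega
    · rw [padVal_of_ge_odd f hx₀ (by omega)]
      omega

/-- `padVal` is a fixed-point-free involution if `f` is one. [folklore] -/
theorem padVal_spec (f : Fin n₀ → Fin n₀) (hf : ∀ v, v ≠ f v ∧ f (f v) = v) (x : ℕ) :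
    padVal n₀ f x ≠ x ∧ padVal n₀ f (padVal n₀ f x) = x := by
  by_cases hx₀ : x < n₀
  · have h1 := hf ⟨x, hx₀⟩
    rw [padVal_of_lt f hx₀, padVal_of_lt f (f ⟨x, hx₀⟩).2]
    refine ⟨fun heq => h1.1 (Fin.ext heq.symm), ?_⟩
    simp only [Fin.eta]
    rw [h1.2]
  · push Not at hx₀
    by_cases hp : (x - n₀) % 2 = 0
    · rw [padVal_of_ge_even f hx₀ hp, padVal_of_ge_odd f (by omega) (by omega)]
      omega
    · rw [padVal_of_ge_odd f hx₀ (by omega), padVal_of_ge_even f (by omega) (by omega)]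
      omega

/-- The padded partner map on `Fin n`. [folklore] -/
def padMap (h : n₀ ≤ n) (he : (n - n₀) % 2 = 0) (f : Fin n₀ → Fin n₀) (x : Fin n) : Fin n :=
  ⟨padVal n₀ f x, padVal_lt h he f x.2⟩

/-- The padded partner map is an adjacency-respecting involution of `K_n`. [folklore] -/
theorem padMap_spec (h : n₀ ≤ n) (he : (n - n₀) % 2 = 0) (f : Fin n₀ → Fin n₀)
    (hf : ∀ v, (⊤ : SimpleGraph (Fin n₀)).Adj v (f v) ∧ f (f v) = v) (x : Fin n) :
    (⊤ : SimpleGraph (Fin n)).Adj x (padMap h he f x) ∧ padMap h he f (padMap h he f x) = x := by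
  have hf' : ∀ v, v ≠ f v ∧ f (f v) = v := fun v => ⟨(SimpleGraph.top_adj _ _).1 (hf v).1, (hf v).2⟩
  have hs := padVal_spec f hf' x
  refine ⟨(SimpleGraph.top_adj _ _).2 fun heq => hs.1 ?_, Fin.ext hs.2⟩
  exact (congrArg Fin.val heq).symm

/-- The padding `M' ∪ {{n₀, n₀+1}, {n₀+2, n₀+3}, …}` of a perfect matching `M'` of `K_{n₀}` to a
perfect matching of `K_n` (`n₀ ≤ n`, `n - n₀` even), built from its partner map. [folklore] -/
noncomputable def padMatching (h : n₀ ≤ n) (he : (n - n₀) % 2 = 0)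
    {M' : (⊤ : SimpleGraph (Fin n₀)).Subgraph} (hM' : M'.IsPerfectMatching) :
    (⊤ : SimpleGraph (Fin n)).Subgraph :=
  partnerSubgraph ⊤ (padMap h he (matchPartner hM'))
    (padMap_spec h he _ fun v =>
      ⟨M'.adj_sub (adj_matchPartner hM' v), matchPartner_matchPartner hM' v⟩)

/-- The padded matching is a perfect matching of `K_n`. [folklore] -/
theorem padMatching_isPerfectMatching (h : n₀ ≤ n) (he : (n - n₀) % 2 = 0)
    {M' : (⊤ : SimpleGraph (Fin n₀)).Subgraph} (hM' : M'.IsPerfectMatching) :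
    (padMatching h he hM').IsPerfectMatching :=
  partnerSubgraph_isPerfectMatching _ _ _

/-- Padding preserves crossing numbers of cuts inside the first `n₀` vertices: the added edges
avoid them. [folklore] -/
theorem crossing_pad (h : n₀ ≤ n) (he : (n - n₀) % 2 = 0)
    {M' : (⊤ : SimpleGraph (Fin n₀)).Subgraph} (hM' : M'.IsPerfectMatching)
    (U' : Finset (Fin n₀)) :
    crossing (U'.map (Fin.castLEEmb h)) (padMatching h he hM') = crossing U' M' := by
  classical
  rw [crossing_eq_card_filter _ (padMatching_isPerfectMatching h he hM'),
    crossing_eq_card_filter U' hM', filter_map, card_map]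
  congr 1
  refine filter_congr fun x _ => ?_
  have hpad : padMap h he (matchPartner hM') (Fin.castLEEmb h x) =
      Fin.castLEEmb h (matchPartner hM' x) := by
    apply Fin.ext
    simp [padMap, padVal_of_lt _ x.2]
  simp only [Function.comp_apply, padMatching, matchPartner_partnerSubgraph, hpad, mem_map']

/-- **Restriction of a non-negative factorisation** (the slack-matrix form of footnote 2 of
Rothvoss 2017: `P_PM(n₀)` is a face of `P_PM(n)`). If the odd-cut slack matrix of `K_n` has a
non-negative factorisation with `r` terms, so does that of `K_{n₀}` for `n₀ ≤ n` with `n - n₀`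
even: compose the row factors with `U' ↦ U'` (pushed into `Fin n`) and the column factors with
`M' ↦ M' ∪ (fixed perfect matching of the remaining vertices)`. [cite: Rothvoss2017, §2 fn. 2] -/
theorem factorisation_restrict (h : n₀ ≤ n) (he : (n - n₀) % 2 = 0) {r : ℕ}
    {a : Finset (Fin n) → Fin r → ℝ} {b : (⊤ : SimpleGraph (Fin n)).Subgraph → Fin r → ℝ}
    (ha : ∀ U i, 0 ≤ a U i) (hb : ∀ M i, 0 ≤ b M i)
    (hab : ∀ (U : Finset (Fin n)) (M : (⊤ : SimpleGraph (Fin n)).Subgraph), Odd U.card →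
      M.IsPerfectMatching → (crossing U M : ℝ) - 1 = ∑ i, a U i * b M i) :
    ∃ (a' : Finset (Fin n₀) → Fin r → ℝ) (b' : (⊤ : SimpleGraph (Fin n₀)).Subgraph → Fin r → ℝ),
      (∀ U i, 0 ≤ a' U i) ∧ (∀ M i, 0 ≤ b' M i) ∧
      ∀ (U : Finset (Fin n₀)) (M : (⊤ : SimpleGraph (Fin n₀)).Subgraph), Odd U.card →
        M.IsPerfectMatching → (crossing U M : ℝ) - 1 = ∑ i, a' U i * b' M i := by
  classical
  refine ⟨fun U i => a (U.map (Fin.castLEEmb h)) i,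
    fun M i => if hM : M.IsPerfectMatching then b (padMatching h he hM) i else 0,
    fun U i => ha _ _, fun M i => ?_, ?_⟩
  · by_cases hM : M.IsPerfectMatching
    · simp only [hM, dif_pos]
      exact hb _ _
    · simp [hM]
  · intro U M hU hM
    simp only [hM, dif_pos]
    rw [← crossing_pad h he hM U]
    exact hab _ _ (by rwa [card_map]) (padMatching_isPerfectMatching h he hM)

end Pad

/-! ### The paper's parameters `n = 3m(k-3) + 2k`, `t = (m+1)/2 · (k-3) + 3` -/

/-- Rothvoss's number of vertices `n = 3m(k-3) + 2k` (p. 6). [cite: Rothvoss2017, §2] -/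
def rvN (k m : ℕ) : ℕ := 3 * m * (k - 3) + 2 * k

/-- Rothvoss's cut size `t = (m+1)/2 · (k-3) + 3` (p. 6). [cite: Rothvoss2017, §2] -/
def rvT (k m : ℕ) : ℕ := (m + 1) / 2 * (k - 3) + 3

/-- `n = 3m(k-3) + 2k` is even for odd `k`. [cite: Rothvoss2017, §2] -/
theorem even_rvN {k : ℕ} (hk : Odd k) (m : ℕ) : Even (rvN k m) := by
  obtain ⟨j, rfl⟩ := hk
  refine Nat.even_iff.2 ?_
  simp only [rvN]
  have : (2 * j + 1 - 3) % 2 = 0 := by omega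
  rw [Nat.add_mod, Nat.mul_mod, this]
  simp

/-- `t = (m+1)/2 · (k-3) + 3` is odd for odd `k`. [cite: Rothvoss2017, §2] -/
theorem odd_rvT {k : ℕ} (hk : Odd k) (m : ℕ) : Odd (rvT k m) := by
  obtain ⟨j, rfl⟩ := hk
  refine Nat.odd_iff.2 ?_
  simp only [rvT]
  have : (2 * j + 1 - 3) % 2 = 0 := by omega
  rw [Nat.add_mod, Nat.mul_mod, this]
  simp

/-- **Choice of `m` from `n`** (footnote 2 of the paper, quantitatively): for `k > 3` and any
`M₀`, every large `n` satisfies `rvN k m ≤ n` for some odd `m ≥ M₀` with `3n ≤ 4 · 3(k-3) · m`.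
[cite: Rothvoss2017, §2 fn. 2] -/
theorem exists_param {k : ℕ} (hk3 : 3 < k) (M₀ : ℕ) :
    ∃ N : ℕ, ∀ n ≥ N, ∃ m, Odd m ∧ M₀ ≤ m ∧ rvN k m ≤ n ∧ 3 * n ≤ 4 * (3 * (k - 3) * m) := by
  set d := 3 * (k - 3) with hd
  have hdpos : 0 < d := by omega
  refine ⟨2 * k + d * (M₀ + 3) + 8 * k + 8 * d, fun n hn => ?_⟩
  set q := (n - 2 * k) / d with hq
  have hq1 : d * q ≤ n - 2 * k := Nat.mul_div_le (n - 2 * k) d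
  have hq2 : n - 2 * k < d * q + d := by
    have h1 := Nat.div_add_mod (n - 2 * k) d
    have h2 := Nat.mod_lt (n - 2 * k) hdpos
    rw [← hq] at h1
    omega
  have hqM : M₀ + 3 ≤ q := by
    refine (Nat.le_div_iff_mul_le hdpos).2 ?_
    have : (M₀ + 3) * d = d * (M₀ + 3) := mul_comm _ _
    omega
  have hrv : ∀ m, rvN k m = d * m + 2 * k := fun m => by simp only [rvN, hd]; ring
  set P := d * q with hP
  set R := d * (M₀ + 3) with hR
  by_cases hpar : q % 2 = 1
  · refine ⟨q, Nat.odd_iff.2 hpar, by omega, ?_, ?_⟩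
    · rw [hrv]
      omega
    · have : 3 * (k - 3) * q = P := by rw [hP, hd]
      rw [this]
      omega
  · refine ⟨q - 1, Nat.odd_iff.2 (by omega), by omega, ?_, ?_⟩
    · rw [hrv, Nat.mul_sub_one]
      omega
    · have : 3 * (k - 3) * (q - 1) = P - d := by rw [hP, hd, Nat.mul_sub_one]
      rw [this]
      omega

end Rothvoss

open Rothvoss

/-- **Rothvoss 2017, §2: "(2) + Lemma 6 ⇒ Theorem 1", slack-matrix form, PROVED.** Suppose that
for some odd `k > 3` and `δ > 0`, for all sufficiently large odd `m` — with `n = 3m(k-3) + 2k`,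
`t = (m+1)/2 · (k-3) + 3` — there is a weight matrix `W` on (vertex sets) × (subgraphs of `K_n`),
vanishing off the pairs (`|U| = t`, `M` a perfect matching), with `⟨W, S⟩ ≥ 1` against the slack
`S_{UM} = |M ∩ δ(U)| - 1` (display (2) of the paper) and `⟨W, R⟩ ≤ 2^{-δ m}` for every rectangle
`R = 𝓤 × 𝓜` of `t`-cuts and perfect matchings containing no entry with `|M ∩ δ(U)| = 1` (Lemma 6;
the `-∞` entries of the printed `W`). Then the odd-cut slack matrix of `K_n` has non-negative rank
`> 2^{c n}` for some `c > 0` and all large even `n`, i.e. `rothvoss_matching_slack_bound` holds: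
by `hyperplane_separation_bound` (Lemma 5) `1 ≤ r · n · 2^{-δ m}` for `n = rvN k m`, and a general
even `n` is reduced to the largest `rvN k m ≤ n` by `Rothvoss.factorisation_restrict`.
[cite: Rothvoss2017, §2 (Lem. 5, (2), Lem. 6, fn. 2)] -/
theorem rothvoss_matching_slack_bound_of_rectangle_bound
    (h : ∃ k : ℕ, Odd k ∧ 3 < k ∧ ∃ δ : ℝ, 0 < δ ∧ ∀ᶠ m : ℕ in Filter.atTop, Odd m →
      ∃ W : Finset (Fin (rvN k m)) → (⊤ : SimpleGraph (Fin (rvN k m))).Subgraph → ℝ,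
        (∀ U M, W U M ≠ 0 → U.card = rvT k m ∧ M.IsPerfectMatching) ∧
        (1 : ℝ) ≤ ∑ U, ∑ M, W U M * ((crossing U M : ℝ) - 1) ∧
        ∀ (𝓤 : Finset (Finset (Fin (rvN k m))))
          (𝓜 : Finset ((⊤ : SimpleGraph (Fin (rvN k m))).Subgraph)),
          (∀ U ∈ 𝓤, U.card = rvT k m) → (∀ M ∈ 𝓜, M.IsPerfectMatching) →
          (∀ U ∈ 𝓤, ∀ M ∈ 𝓜, crossing U M ≠ 1) →
            ∑ U ∈ 𝓤, ∑ M ∈ 𝓜, W U M ≤ (2 : ℝ) ^ (-(δ * (m : ℝ)))) :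
    rothvoss_matching_slack_bound := by
  classical
  obtain ⟨k, hk, hk3, δ, hδ, hev⟩ := h
  obtain ⟨M₀, hM₀⟩ := Filter.eventually_atTop.1 hev
  obtain ⟨N₁, hN₁⟩ := exists_param hk3 M₀
  set d : ℕ := 3 * (k - 3) with hd
  have hdpos : (0 : ℝ) < d := by
    have : 0 < d := by omega
    exact_mod_cast this
  set c : ℝ := δ / (4 * d) with hc
  have hcpos : 0 < c := by positivity
  have hlittle := (isLittleO_pow_const_const_pow_of_one_lt (R := ℝ) 1
    (Real.one_lt_rpow (by norm_num : (1 : ℝ) < 2) hcpos)).def zero_lt_one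
  obtain ⟨N₂, hN₂⟩ := Filter.eventually_atTop.1 hlittle
  refine ⟨c, hcpos, Filter.eventually_atTop.2 ⟨max N₁ (max N₂ 1), fun n hn => ?_⟩⟩
  intro hne r hr a b ha hb hfac
  have hnN₁ : N₁ ≤ n := le_trans (le_max_left _ _) hn
  have hnN₂ : N₂ ≤ n := le_trans ((le_max_left _ _).trans (le_max_right _ _)) hn
  have hn1 : 1 ≤ n := le_trans ((le_max_right _ _).trans (le_max_right _ _)) hn
  obtain ⟨m, hmo, hmM, hmn, hmn'⟩ := hN₁ n hnN₁
  obtain ⟨W, hWsupp, hWS, hWR⟩ := hM₀ m hmM hmo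
  -- restrict the factorisation of `K_n` to `K_{n₀}`, `n₀ = rvN k m`
  have he : (n - rvN k m) % 2 = 0 :=
    Nat.even_iff.1 ((Nat.even_sub hmn).2 ⟨fun _ => even_rvN hk m, fun _ => hne⟩)
  obtain ⟨a', b', ha', hb', hfac'⟩ :=
    factorisation_restrict hmn he ha hb fun U M hU hM => hfac U M hU hM
  -- Lemma 5 on the rows `|U| = t` and the columns "perfect matchings"
  set X₀ : Finset (Finset (Fin (rvN k m))) := univ.filter fun U => U.card = rvT k m with hX₀
  set Y₀ : Finset ((⊤ : SimpleGraph (Fin (rvN k m))).Subgraph) :=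
    univ.filter fun M => M.IsPerfectMatching with hY₀
  have hS0 : ∀ U ∈ X₀, ∀ M ∈ Y₀, (crossing U M : ℝ) - 1 = ∑ i, a' U i * b' M i := fun U hU M hM =>
    hfac' U M (by rw [(mem_filter.1 hU).2]; exact odd_rvT hk m) (mem_filter.1 hM).2
  have key := hyperplane_separation_bound X₀ Y₀ W (fun U M => ∑ i, a' U i * b' M i)
    {p | crossing p.1 p.2 = 1} ((2 : ℝ) ^ (-(δ * (m : ℝ)))) (rvN k m : ℝ) (Nat.cast_nonneg _)
    (fun A hA B hB hAB => hWR A B (fun U hU => (mem_filter.1 (hA hU)).2)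
      (fun M hM => (mem_filter.1 (hB hM)).2) (fun U hU M hM h1 => hAB U hU M hM h1))
    (fun U hU M hM hZ => by
      have h1 : crossing U M = 1 := hZ
      rw [← hS0 U hU M hM, h1]
      simp)
    (fun U hU M hM => by
      rw [← hS0 U hU M hM]
      have h1 : crossing U M ≤ rvN k m :=
        (crossing_le_card U (mem_filter.1 hM).2).trans (by simpa using card_le_univ U)
      have h2 : (crossing U M : ℝ) ≤ rvN k m := by exact_mod_cast h1
      linarith)
    a' b' ha' hb' (fun _ _ _ _ => rfl)
  -- `⟨W, S⟩` over `X₀ × Y₀` is the full sum, which is `≥ 1`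
  have hsum : ∑ U, ∑ M, W U M * ((crossing U M : ℝ) - 1) =
      ∑ U ∈ X₀, ∑ M ∈ Y₀, W U M * ∑ i, a' U i * b' M i := by
    symm
    rw [sum_subset (subset_univ X₀)]
    · refine sum_congr rfl fun U _ => ?_
      by_cases hU : U.card = rvT k m
      · rw [sum_subset (subset_univ Y₀)]
        · refine sum_congr rfl fun M _ => ?_
          by_cases hM : M.IsPerfectMatching
          · rw [hS0 U (mem_filter.2 ⟨mem_univ _, hU⟩) M (mem_filter.2 ⟨mem_univ _, hM⟩)]
          · have : W U M = 0 := not_not.1 fun hW => hM (hWsupp U M hW).2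
            simp [this]
        · intro M _ hM
          have hM' : ¬ M.IsPerfectMatching := fun h' => hM (mem_filter.2 ⟨mem_univ _, h'⟩)
          have : W U M = 0 := not_not.1 fun hW => hM' (hWsupp U M hW).2
          simp [this]
      · have hW0 : ∀ M, W U M = 0 := fun M => not_not.1 fun hW => hU (hWsupp U M hW).1
        simp [hW0]
    · intro U _ hU
      have hU' : ¬ U.card = rvT k m := fun h' => hU (mem_filter.2 ⟨mem_univ _, h'⟩)
      have hW0 : ∀ M, W U M = 0 := fun M => not_not.1 fun hW => hU' (hWsupp U M hW).1
      simp [hW0]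
  rw [hsum] at hWS
  have hmain : (1 : ℝ) ≤ r * (rvN k m * (2 : ℝ) ^ (-(δ * (m : ℝ)))) := hWS.trans key
  -- arithmetic: `r ≤ 2^{cn}`, `rvN k m ≤ n ≤ 2^{cn}`, `δ m ≥ 3 c n` contradict `hmain`
  have hn2 : (n : ℝ) ≤ (2 : ℝ) ^ (c * n) := by
    have h' := hN₂ n hnN₂
    rw [pow_one, one_mul, Real.norm_of_nonneg (Nat.cast_nonneg _),
      Real.norm_of_nonneg (by positivity), ← Real.rpow_natCast,
      ← Real.rpow_mul (by norm_num : (0 : ℝ) ≤ 2)] at h'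
    exact h'
  have hm3 : 3 * c * n ≤ δ * m := by
    have h1 : (3 : ℝ) * n ≤ 4 * (d * m) := by
      have : ((3 * n : ℕ) : ℝ) ≤ ((4 * (3 * (k - 3) * m) : ℕ) : ℝ) := by exact_mod_cast hmn'
      push_cast at this
      simpa [hd] using this
    rw [hc, show 3 * (δ / (4 * (d : ℝ))) * n = δ * (3 * n) / (4 * d) by ring,
      div_le_iff₀ (by positivity)]
    calc δ * (3 * (n : ℝ)) ≤ δ * (4 * (d * m)) := mul_le_mul_of_nonneg_left h1 hδ.le
      _ = δ * m * (4 * d) := by ring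
  have hn₀n : (rvN k m : ℝ) ≤ n := by exact_mod_cast hmn
  have two_pos : (0 : ℝ) < 2 := by norm_num
  have hexp : (2 : ℝ) ^ (-(δ * (m : ℝ))) ≤ (2 : ℝ) ^ (-(3 * c * n)) :=
    Real.rpow_le_rpow_of_exponent_le (by norm_num) (by linarith)
  have hbound : (r : ℝ) * (rvN k m * (2 : ℝ) ^ (-(δ * (m : ℝ)))) ≤
      (2 : ℝ) ^ (c * n) * ((2 : ℝ) ^ (c * n) * (2 : ℝ) ^ (-(3 * c * n))) := by
    have h0 : (0 : ℝ) ≤ (2 : ℝ) ^ (-(δ * (m : ℝ))) := by positivity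
    calc (r : ℝ) * (rvN k m * (2 : ℝ) ^ (-(δ * (m : ℝ))))
        ≤ (2 : ℝ) ^ (c * n) * (rvN k m * (2 : ℝ) ^ (-(δ * (m : ℝ)))) :=
          mul_le_mul_of_nonneg_right hr (by positivity)
      _ ≤ (2 : ℝ) ^ (c * n) * ((2 : ℝ) ^ (c * n) * (2 : ℝ) ^ (-(3 * c * n))) := by
          refine mul_le_mul_of_nonneg_left ?_ (by positivity)
          exact mul_le_mul (hn₀n.trans hn2) hexp h0 (by positivity)
  have hcollapse : (2 : ℝ) ^ (c * n) * ((2 : ℝ) ^ (c * n) * (2 : ℝ) ^ (-(3 * c * n))) =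
      (2 : ℝ) ^ (-(c * n)) := by
    rw [← Real.rpow_add two_pos, ← Real.rpow_add two_pos]
    congr 1
    ring
  have hlt : (2 : ℝ) ^ (-(c * n)) < 1 := by
    refine Real.rpow_lt_one_of_one_lt_of_neg (by norm_num) ?_
    have : (0 : ℝ) < c * n := mul_pos hcpos (by exact_mod_cast hn1)
    linarith
  linarith [hmain, hbound, hcollapse, hlt]

end Literature.Computability.Complexity
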